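import Summits.CriticalPhenomena.PercolationContinuityZ3.Theorems.PercNearOneGluingNoHeavyQuantGreedyOptimal
import Summits.CriticalPhenomena.PercolationContinuityZ3.Theorems.PercNearOneGluingNoHeavyQuantFlowUncross
import HarnessLib

/-!
# QUANT lane R8, T-DEC: Theorem G IN DEC VOCABULARY — the SW greedy credit flow at the DEC rates `LawDec.usage` is optimal for every prefix of mids
# (lead g25; instantiation of `…QuantGreedyOptimal` with lead g21's `usage_anti_low` / `usage_monge`)

builds on p205010 (kernel theorem, internal audit signed; external expert review pending)

Support file (`--supports stmt-CriticalPhenomena-4575`), QUANT lane lead seat (gen 25), rung R8 of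
`run/shared/lean/prim/quant/LADDER.md`.  One `Prop` definition (`LawDec.decRel`, the row/column/compatibility relation of the DEC transportation
problem) with its classical decidability instance; theorems with standard axioms, no sorries.

For a target `T`, floor `0 < x < 1` and top layer `j`: rows = lows `l` (`2l < T`), columns = mids `h` (`T ≤ 2h`), compatible iff `T < l + h`
(`LawDec.decRel T l h`); rates `u l h = LawDec.usage x T j l h` (independent of `j` on mids `h ≤ j`).  The abstract hypotheses of
`Greedy.val_le_sum_flow_prefix` hold: rates positive on compatible cells (`usage_pos_of_compat`, typer g23), compatibility up-closed in the column,
antitone in the row and MONGE for rows that are lows (`usage_anti_low`, `usage_monge`, lead g21).  Hence: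
* **`LawDec.creditFlow_le_greedy_prefix`** — for any finite sets `L` of lows and `H` of mids, nonnegative masses, and every `t`: every credit flow into the
  mids `≤ t` ships at most as much low mass as the SW greedy flow of `(L, H)` puts into the mids `≤ t`.  With the pool reduction this is the "universal
  flow" of the window-atom decomposition (FOR-PROVERS-WINDOW-ATOMS.md §2; an abstract twin of `LawDec.cornerTheorem_holds` + `…QuantCornerPrefix`).

[this work].  The gluing rows served [cite: KozmaNitzan2024, Conjecture 3 (p. 15)]; product measure [cite: Grimmett1999, §1.3 p. 10].
-/

noncomputable section
namespace Summit.CriticalPhenomena.PercolationContinuityZ3.Theorems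
namespace Quant
namespace LawDec

open Finset

/-- **the DEC transportation relation at target `T`**: `l` is a low (`2l < T`), `h` a mid (`T ≤ 2h`), and the pair is compatible (`T < l + h`).
[this work] -/
def decRel (T : ℝ) (l h : ℕ) : Prop := 2 * (l : ℝ) < T ∧ T ≤ 2 * (h : ℝ) ∧ T < (l : ℝ) + h

/-- classical decidability of `decRel` (the greedy recursion branches on it). [this work] -/
instance decRel.instDecidableRel (T : ℝ) : DecidableRel (decRel T) := fun _ _ => Classical.propDecidable _

/-- `decRel` is up-closed in the column. [this work] -/
theorem decRel_mono_col (T : ℝ) (l h k : ℕ) (hhk : h ≤ k) (hP : decRel T l h) : decRel T l k := by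
  obtain ⟨h1, h2, h3⟩ := hP
  have hhk' : (h : ℝ) ≤ k := by exact_mod_cast hhk
  exact ⟨h1, h2.trans (by linarith), by linarith⟩

/-- the DEC rates are positive on compatible cells (`0 < x < 1`). [this work] -/
theorem usage_pos_of_decRel (x T : ℝ) (j : ℕ) (hx0 : 0 < x) (hx1 : x < 1) (l h : ℕ) (hP : decRel T l h) :
    0 < usage x T j l h := by
  obtain ⟨h1, _, h3⟩ := hP
  have hlh : (l : ℝ) < h := by linarith
  exact usage_pos_of_compat x T j l h hx0 hx1 h1 (by exact_mod_cast hlh) (Or.inr h3)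

/-- antitonicity in the row, in the abstract shape (both rows lows). [this work] -/
theorem usage_anti_of_decRel (x T : ℝ) (j : ℕ) (hx0 : 0 < x) (hx1 : x < 1) (L : Finset ℕ) (hL : ∀ l ∈ L, 2 * (l : ℝ) < T) :
    ∀ l ∈ L, ∀ l' ∈ L, ∀ h, l < l' → decRel T l h → usage x T j l' h ≤ usage x T j l h := by
  intro l _ l' hl' h hlt hP
  obtain ⟨_, h2, h3⟩ := hP
  exact usage_anti_low x T j l l' h hx0 hx1 hlt (hL l' hl') h3 (Or.inr h2)

/-- the Monge inequality, in the abstract shape (both rows lows). [this work] -/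
theorem usage_monge_of_decRel (x T : ℝ) (j : ℕ) (hx0 : 0 < x) (hx1 : x < 1) (L : Finset ℕ) (hL : ∀ l ∈ L, 2 * (l : ℝ) < T) :
    ∀ l ∈ L, ∀ l' ∈ L, ∀ h k, l < l' → h < k → decRel T l h →
      usage x T j l' h * usage x T j l k ≤ usage x T j l h * usage x T j l' k := by
  intro l _ l' hl' h k hlt hhk hP
  obtain ⟨_, h2, h3⟩ := hP
  exact usage_monge x T j l l' h k hx0 hx1 hlt hhk (hL l' hl') h3 (Or.inr h2)

/-- **THEOREM G IN DEC VOCABULARY (universal credit flow).**  `0 < x < 1`; `L` a finite set of lows (`2l < T`), `H` any finite set of columns, nonnegative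
masses `μ` and capacities `c`; for every threshold `t` and every credit flow `f` at the rates `usage x T j` on the `decRel T`-compatible cells of
`L × {h ∈ H : h ≤ t}`:  `Σ f ≤ Σ_{l ∈ L} Σ_{h ∈ H, h ≤ t} (SW greedy flow of (L, H)) l h`. [this work] -/
theorem creditFlow_le_greedy_prefix (x T : ℝ) (j : ℕ) (hx0 : 0 < x) (hx1 : x < 1) (L H : Finset ℕ) (hL : ∀ l ∈ L, 2 * (l : ℝ) < T)
    (μ c : ℕ → ℝ) (hμ : ∀ l ∈ L, 0 ≤ μ l) (hc : ∀ h ∈ H, 0 ≤ c h) (t : ℕ) (f : ℕ → ℕ → ℝ)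
    (hf : Greedy.IsFlow (usage x T j) (decRel T) L (H.filter (· ≤ t)) μ c f) :
    Greedy.val L (H.filter (· ≤ t)) f ≤ ∑ l ∈ L, ∑ h ∈ H.filter (· ≤ t), Greedy.flow (usage x T j) (decRel T) L H μ c l h :=
  Greedy.val_le_sum_flow_prefix (usage x T j) (decRel T) (fun l h hP => usage_pos_of_decRel x T j hx0 hx1 l h hP)
    (fun l h k hhk hP => decRel_mono_col T l h k hhk hP) L H μ c (usage_anti_of_decRel x T j hx0 hx1 L hL)
    (usage_monge_of_decRel x T j hx0 hx1 L hL) hμ hc t f hf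

/-- the greedy at the DEC rates is itself a credit flow (nonnegative data). [this work] -/
theorem greedy_isFlow_dec (x T : ℝ) (j : ℕ) (hx0 : 0 < x) (hx1 : x < 1) (L H : Finset ℕ) (μ c : ℕ → ℝ)
    (hμ : ∀ l ∈ L, 0 ≤ μ l) (hc : ∀ h ∈ H, 0 ≤ c h) :
    Greedy.IsFlow (usage x T j) (decRel T) L H μ c (Greedy.flow (usage x T j) (decRel T) L H μ c) :=
  Greedy.isFlow_flow (usage x T j) (decRel T) (fun l h hP => usage_pos_of_decRel x T j hx0 hx1 l h hP) L H μ c hμ hc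

end LawDec
end Quant
end Summit.CriticalPhenomena.PercolationContinuityZ3.Theorems
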